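/- Copyright: the b2b-balaban cell (near-miss cell 7), T⁴-continuum fan-out; row NE7b CRUX team (2), seat
t4-ne7b-formalise-leaf-04 (gen 34) — the located question Q-leaf04g32-1 (`CLAIMS.log` l.31550) answered by the row OWNER
t4-ne7b-p1 (gen 47, `CLAIMS.log` l.31911: «v3.1′ re-homing: YES, as an INTERFACE REQUEST → leaf-04»): leaf-02's weighted
witness `CountRoadWitnessT3bWTVS` (`HistoryRealiseCellsRunApexT3bWTVS`, p265435) and VS-headline (`HistoryRealiseCellsRunHeadlineT3bWTVS`,
p266167) RE-HOMED on the repaired END v3.1 through the sibling `HistoryRealiseCellsRunApexT3bPWTV`.  Released under the licence of the surrounding project. -/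
import Summits.QuantumFields.BalabanUV.T4Continuum.Support.HistoryRealiseCellsRunApexT3bPWTV
import Summits.QuantumFields.BalabanUV.T4Continuum.Support.HistoryRealiseCellsRunApexT3bWTVS

/-!
# Realised histories: ROW NE7b AT THE APEX AND THE HEADLINE OVER THE REPAIRED END v3.1 FROM THE WEIGHTED `κ := costT`
WITNESS, SPLIT SLACK `C.a + (θ + θᵥ) ≤ ½γ₀A₁²` — NO DEMAND ON PRINT's CONSTANTS (the VS-headline re-homed on the v3.1′
chain)

Summits-side support leaf of the T⁴-continuum cell (rung (B)+1 on a FINITE torus only; NOT infinite volume, NOT the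
mass gap, NOT the Clay statement; NOT a proof of the spine estimate NE7b, which is the cell's OWN estimate, NOT PRINTED
and NOT PROVED).  [folklore] composition by name: the sibling's `HistoryRealiseCellsRunApexT3bPWTV.hybridNE7Under_of_countRoadT3bPWTV_fsc`
∕ `limit_exists_of_countRoadT3bPWTV_fsc` ∕ `limit_unique_of_countRoadT3bPWTV_fsc` ∕ `targets_of_countRoadT3bPWTV_fsc` ∕
`continuumYM4Torus_of_countRoadT3bPWTV_fsc` (the owner's `κ := costT` witness over leaf-02's E8T) AT THE RE-SLACKED RECORD
`reslack O θᵥ`, fed by leaf-02's embedding `HistoryRealiseCellsRunApexT3bWTVS.CountRoadWitnessT3bWTVS.toWTV` and slack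
identity `reslack_hslack` (p265435, the VS-headline p266167's apex module); no definition, no `[cite:]` tag, nothing printed asserted, no `Prop`
fact minted, zero `sorry`.  Append-only: leaf-02's VS-apex ∕ VS-headline (`HistoryRealiseCellsRunApexT3bWTVS` p265435 ∕
`HistoryRealiseCellsRunHeadlineT3bWTVS` p266167), the owner's V-headline p263890, E7T, E8T and the headline of record
p224237 stay, UNCHANGED BY NAME.

WHY (question Q-leaf04g32-1, `CLAIMS.log` l.31550; owner's answer l.31911).  Leaf-02's VS-headline
`HistoryRealiseCellsRunHeadlineT3bWTVS.continuumYM4Torus_of_countRoadT3bWTVS_fsc` — the headline the (α) assembly SPEC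
IR-46-2 §1 targets (`Nonempty (CountRoadWitnessT3bWTVS …)` per datum, then `continuumYM4Torus_of_histReading_fsc`) — is
the owner's V-headline at `reslack O θᵥ`, hence plugged on E7T (END v3′) and carries the demand `hθJ : ΘJ(d, sS, θc) +
8·2^d·log(2d+1) ≤ θ` next to the split slack `C.a + (θ + θᵥ) ≤ ½γ₀A₁²`: together a demand on PRINT's `O(1)` constants
(WALL T4′, located point L-ne7bleaf04g32-1).  The sibling re-homes the V-headline on the repaired END v3.1 (E8T: `0 < θ`,
plain slack, NO `hθJ`, constants-only side conditions inhabited); this file carries the re-homing to the VS level by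
the SAME two devices leaf-02 used (`toWTV`, `reslack_hslack`), so that the (α) assembly's output record — unchanged, a
`CountRoadWitnessT3bWTVS D C O θᵥ …` — has a headline WITHOUT the demand on print's constants.

WHAT.  §1 **`hybridNE7Under_of_countRoadT3bPWTVS_fsc`** (apex input), `limit_exists_of_countRoadT3bPWTVS_fsc`,
`limit_unique_of_countRoadT3bPWTVS_fsc`; §2 `targets_of_countRoadT3bPWTVS_fsc`, **`continuumYM4Torus_of_countRoadT3bPWTVS_fsc`**
(headline): leaf-02's two VS statements (and E8T's three corollaries) with EXACTLY these edits against
`HistoryRealiseCellsRunHeadlineT3bWTVS` — `hθ : 0 < θ` in place of `0 ≤ θ`, NO `hθJ`; the prefixed witness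
`CountRoadWitnessT3bWTVS D C O θᵥ …` and the split slack `hslack : C.a + (θ + θv) ≤ O.γ₀ * O.A₁ ^ 2 / 2` as there (`θᵥ`
free, no sign hypothesis); conclusions (`T4ApexHybrid.HybridNE7Under D (BetaPertHyp D.βfun)`,
`D.ym4_torus_continuum_limit_exists ∕ _unique`, the four targets, `T4ContinuumYM4Torus.ContinuumYM4Torus D`) BYTE-IDENTICAL.
§3 one closing `example`: THE RE-HOMED VS-HEADLINE IS AT LEAST AS STRONG AS LEAF-02's VS-HEADLINE p266167 — from p266167's
OWN hypotheses (binders LITERALLY those of `continuumYM4Torus_of_countRoadT3bWTVS_fsc`, `hθ : 0 ≤ θ` and `hθJ` included)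
its conclusion follows through THIS file's headline (`hθJ`'s left side is `≥ 12`, so `0 < θ`); an `example`, not a named
theorem, because its statement IS p266167's.  §4 `exists_consts_countRoadT3bPWTVS`: the constants-side antecedent of §1∕§2 is
INHABITED with `0 < θᵥ` (p224237's `exists_consts_countRoadT3bP`, slack halved).

BY-NAME EFFECT ON THE WALL (`WALL-NE7b-P1.md` §2, for the owner to record): NONE on the R∕S∕K∕C class of any binder (the
witness record is leaf-02's, unchanged — price sentences at the model's booked cost with the displayed weight family `uV`
under D-V1, credit part and dead part READ); the caveat of WALL T4′ LEAVES the VS-headline and therefore the (α)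
assembly's terminal statement; constants-only side conditions = E8T's (inhabited).  DISPLAYED, NOT DISCHARGED (unchanged
list): H3^NE7b's `realised` reading and numerator readings, (B) `B16.EndStatementBPrinted`, `BetaPertHyp`, the flow box
bounds ∕ tuning ∕ IR smallness (`ForSmallCouplings`), NE7c's `ShellWeightBound`, NE7's `ReindexedBudget` + four summable
rates.  HONEST: NE7b NOT proved; spine 0∕9; rung (B)+1 finite T⁴ — NOT infinite volume, NOT mass gap, NOT Clay.  HONEST
DEPENDENCY (cell): continuum YM on T⁴ ⇐ BetaPertH ∧ nine spine estimates (0/9 proved); BetaPertH ⇐ (D1) ∧ (D4) ∧ CAP+tail;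
G-an2-4 gates asym, D1 and NE2/3/4.  This file changes none of it.

v1.1 (seat t4-ne7b-formalise-leaf-04, gen 37; DOCSTRING ONLY — every declaration, binder, proof, `import` and `open` line of
v1 = p281090 is byte-identical) — SUPERSESSION-OF-RECORD MARKING (referee `t4/formal/NE7b/REFEREE.md` pass 60, OI-77; the
OWNER's word W-ne7bp1-g49-2, `CLAIMS.log` l.33573).  SUPERSEDED IN PLACE (R-OWNER-48-1 «THE GUARDED CUT»): the witness
field `disjointJoins` carried by `CountRoadWitnessT3bWTVS` (and by every W ∕ WT ∕ WTV count-road witness) is MISSTATED AS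
TYPED — the unguarded display `DisjointJoins` compares birth regions across labels and is unsatisfiable on non-trivial
genealogies (`HistoryRealiseDistinctGuarded.Sanity.not_disjointJoins_nestedToy`), so the `hData` prefix of the five
theorems of §1–§2 is not an honest hypothesis for the (α) assembly to inhabit.  OF RECORD INSTEAD: the inhabitable record ∕
witness is `HistReadDataL` (`HistoryRealiseCellsRunAssemblyWTVSDataL`; prefix form `HistReadDataLW`,
`HistoryRealiseCellsRunAssemblyWTVSDataLW`) ∕ `CountRoadWitnessT3bWTVSL` (`HistoryRealiseCellsRunApexT3bWTVSL`); the
guarded twin of THIS file's headline is L3b `HistoryRealiseCellsRunHeadlineT3bPWTVSL.continuumYM4Torus_of_countRoadT3bPWTVSL_fsc`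
(binders verbatim except `CountRoadWitnessT3bWTVS ↦ CountRoadWitnessT3bWTVSL`, conclusion byte-identical); the terminal
theorem is `HistoryRealiseCellsRunAssemblyWTVSL.continuumYM4Torus_of_histReadingL_fsc`, and its prefix twin
`HistoryRealiseCellsRunAssemblyWTVSLW.continuumYM4Torus_of_histReadingLW_fsc` (SPEC D-48-1, IR-48-3) is the (α) terminal
theorem of record.  NOT superseded: §4 `exists_consts_countRoadT3bPWTVS` — the L-chain's constants side is served by it BY
NAME (no twin) — and §3's `example` (the V-headline junction).  Every landed VS-witness is an L-witness by the owner's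
`CountRoadWitnessT3bWTVS.toL`, so L ⊒ B by name; nothing is deleted (the gate is append-only), importers are unaffected,
no by-name class of any WALL-NE7b-P1 §2 binder moves.  NE7b NOT proved; spine 0∕9.  HONEST DEPENDENCY: continuum YM on T⁴ ⇐ BetaPertH ∧ nine spine estimates (0/9 proved); BetaPertH ⇐ (D1) ∧ (D4) ∧ CAP+tail; G-an2-4 gates asym, D1 and NE2/3/4. -/

open Literature.MathematicalPhysics.QuantumFieldTheory.Balaban1983to89
open T4Continuum T4PrintedShapeBanking T4CanonicalMenus
open Summit.QuantumFields.BalabanUV.T4Continuum.CountThresholdUniform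
open Summit.QuantumFields.BalabanUV.T4Continuum.HistoryConstants
open Summit.QuantumFields.BalabanUV.T4Continuum.HistoryZoneEvolve (cth)
open Summit.QuantumFields.BalabanUV.T4Continuum.HistoryRealiseCellsRunApexT3bWT
open Summit.QuantumFields.BalabanUV.T4Continuum.HistoryRealiseCellsRunApexT3bWTV
open Summit.QuantumFields.BalabanUV.T4Continuum.HistoryRealiseCellsRunApexT3bWTVS
open Summit.QuantumFields.BalabanUV.T4Continuum.HistoryRealiseCellsRunApexT3bPWTV
open Summit.QuantumFields.BalabanUV.T4Continuum.HistoryRealiseCellsRunHeadlineT3bP (exists_consts_countRoadT3bP)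

namespace Summit.QuantumFields.BalabanUV.T4Continuum.HistoryRealiseCellsRunHeadlineT3bPWTVS

noncomputable section

section Under

variable {F : T4Family} {G : Type*} [GaugeGroup G] [MeasurableSpace G] [HaarData G] [RegularGaugeGroup G]

/-! ## §1 The apex input over the repaired END v3.1 from the weighted witness -/

/-- **ROW NE7b AT THE APEX OVER THE REPAIRED END v3.1 FROM THE WEIGHTED `κ := costT` WITNESS, SPLIT SLACK, NO DEMAND ON
PRINT's CONSTANTS**: the sibling's `hybridNE7Under_of_countRoadT3bPWTV_fsc` at `reslack O θᵥ` through leaf-02's `toWTV`;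
hypothesis `CountRoadWitnessT3bWTVS D C O θᵥ …`, slack `C.a + (θ + θᵥ) ≤ ½γ₀A₁²`, `0 < θ`, NO `hθJ`; conclusion
identical.  CONDITIONAL; NE7b NOT proved. [folklore] -/
theorem hybridNE7Under_of_countRoadT3bPWTVS_fsc (D : FiniteEpsData F G) (hM : D.AvgMeasurable)
    (hsign : B16.SignConventions D.C)
    {C : T4PrintedShapeBanking.Consts} {O : PrintedO1s}
    {rr : ℕ} {β₀ : ℝ} (h : ThresholdOK C F.L rr β₀) (hμ : 0 < C.μ) (d n : ℕ)
    (hκ₁ : (d : ℝ) * Real.log F.L + 2 * Real.log 2 ≤ C.κ₁) (hE₀ : Real.log (2 + birthMass C) ≤ C.E₀)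
    (hA₀ : 1 ≤ C.A₀) (hβ₀ : 0 < β₀) (hLβ : (F.L : ℝ) * β₀ ≤ 1) (hn₁ : 13 ≤ C.n₁) (hn : 0 < n)
    {θ θv : ℝ} (hθ : 0 < θ) (hslack : C.a + (θ + θv) ≤ O.γ₀ * O.A₁ ^ 2 / 2)
    (hE₂ : 0 < C.E₂) (hE₃ : 0 ≤ C.E₃) {sS : ℕ} (hsS : 1 ≤ sS)
    (hsmall : (((2 * cth 32 1 sS + 1) ^ d : ℕ) : ℝ) * (5 : ℝ) ^ d * ((max 1 (2 * 32 + 2) : ℕ) : ℝ) ≤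
      (F.L : ℝ) ^ (sS / 2) / 2)
    {θc : ℝ} (hθc0 : 0 ≤ θc) (hθc1 : θc < 1) (hθcs : 1 / 2 ≤ θc ^ sS)
    (hData : T4ContinuumYM4Torus.ForSmallCouplings D fun g₀ => ∀ os : List (ULoop F),
        ∃ (ι α π : Type) (_ : DecidableEq ι) (_ : DecidableEq α) (_ : DecidableEq π),
          Nonempty (CountRoadWitnessT3bWTVS D C O θv rr d n hn g₀ os ι α π)) :
    T4ApexHybrid.HybridNE7Under D (BetaPertHyp D.βfun) :=
  hybridNE7Under_of_countRoadT3bPWTV_fsc D hM hsign h hμ d n hκ₁ hE₀ hA₀ hβ₀ hLβ hn₁ hn hθ (reslack_hslack hslack) hE₂ hE₃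
    hsS hsmall hθc0 hθc1 hθcs
    (hData.mono fun g₀ hg os => by
      obtain ⟨ι, α, π, i₁, i₂, i₃, ⟨X⟩⟩ := hg os
      exact ⟨ι, α, π, i₁, i₂, i₃, ⟨X.toWTV⟩⟩)

/-- **COROLLARY: EXISTENCE** of the continuum limit of every joint expectation of unit-scale averaged loop variables
(`D.ym4_torus_continuum_limit_exists`), GIVEN the prefixed weighted witnesses — by
`T4ApexHybrid.limit_exists_of_hybridNE7Under`.  CONDITIONAL; NE7b NOT proved. [folklore] -/
theorem limit_exists_of_countRoadT3bPWTVS_fsc (D : FiniteEpsData F G) (hM : D.AvgMeasurable)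
    (hsign : B16.SignConventions D.C)
    {C : T4PrintedShapeBanking.Consts} {O : PrintedO1s}
    {rr : ℕ} {β₀ : ℝ} (h : ThresholdOK C F.L rr β₀) (hμ : 0 < C.μ) (d n : ℕ)
    (hκ₁ : (d : ℝ) * Real.log F.L + 2 * Real.log 2 ≤ C.κ₁) (hE₀ : Real.log (2 + birthMass C) ≤ C.E₀)
    (hA₀ : 1 ≤ C.A₀) (hβ₀ : 0 < β₀) (hLβ : (F.L : ℝ) * β₀ ≤ 1) (hn₁ : 13 ≤ C.n₁) (hn : 0 < n)
    {θ θv : ℝ} (hθ : 0 < θ) (hslack : C.a + (θ + θv) ≤ O.γ₀ * O.A₁ ^ 2 / 2)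
    (hE₂ : 0 < C.E₂) (hE₃ : 0 ≤ C.E₃) {sS : ℕ} (hsS : 1 ≤ sS)
    (hsmall : (((2 * cth 32 1 sS + 1) ^ d : ℕ) : ℝ) * (5 : ℝ) ^ d * ((max 1 (2 * 32 + 2) : ℕ) : ℝ) ≤
      (F.L : ℝ) ^ (sS / 2) / 2)
    {θc : ℝ} (hθc0 : 0 ≤ θc) (hθc1 : θc < 1) (hθcs : 1 / 2 ≤ θc ^ sS)
    (hData : T4ContinuumYM4Torus.ForSmallCouplings D fun g₀ => ∀ os : List (ULoop F),
        ∃ (ι α π : Type) (_ : DecidableEq ι) (_ : DecidableEq α) (_ : DecidableEq π),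
          Nonempty (CountRoadWitnessT3bWTVS D C O θv rr d n hn g₀ os ι α π)) :
    D.ym4_torus_continuum_limit_exists :=
  T4ApexHybrid.limit_exists_of_hybridNE7Under D hM
    (hybridNE7Under_of_countRoadT3bPWTVS_fsc D hM hsign h hμ d n hκ₁ hE₀ hA₀ hβ₀ hLβ hn₁ hn hθ hslack hE₂ hE₃ hsS hsmall
      hθc0 hθc1 hθcs hData)

/-- **COROLLARY: UNIQUENESS** of the limit points (`D.ym4_torus_continuum_limit_unique`) under the same displayed data — by
`T4ApexHybrid.limit_unique_of_hybridNE7Under`.  CONDITIONAL; NE7b NOT proved. [folklore] -/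
theorem limit_unique_of_countRoadT3bPWTVS_fsc (D : FiniteEpsData F G) (hM : D.AvgMeasurable)
    (hsign : B16.SignConventions D.C)
    {C : T4PrintedShapeBanking.Consts} {O : PrintedO1s}
    {rr : ℕ} {β₀ : ℝ} (h : ThresholdOK C F.L rr β₀) (hμ : 0 < C.μ) (d n : ℕ)
    (hκ₁ : (d : ℝ) * Real.log F.L + 2 * Real.log 2 ≤ C.κ₁) (hE₀ : Real.log (2 + birthMass C) ≤ C.E₀)
    (hA₀ : 1 ≤ C.A₀) (hβ₀ : 0 < β₀) (hLβ : (F.L : ℝ) * β₀ ≤ 1) (hn₁ : 13 ≤ C.n₁) (hn : 0 < n)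
    {θ θv : ℝ} (hθ : 0 < θ) (hslack : C.a + (θ + θv) ≤ O.γ₀ * O.A₁ ^ 2 / 2)
    (hE₂ : 0 < C.E₂) (hE₃ : 0 ≤ C.E₃) {sS : ℕ} (hsS : 1 ≤ sS)
    (hsmall : (((2 * cth 32 1 sS + 1) ^ d : ℕ) : ℝ) * (5 : ℝ) ^ d * ((max 1 (2 * 32 + 2) : ℕ) : ℝ) ≤
      (F.L : ℝ) ^ (sS / 2) / 2)
    {θc : ℝ} (hθc0 : 0 ≤ θc) (hθc1 : θc < 1) (hθcs : 1 / 2 ≤ θc ^ sS)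
    (hData : T4ContinuumYM4Torus.ForSmallCouplings D fun g₀ => ∀ os : List (ULoop F),
        ∃ (ι α π : Type) (_ : DecidableEq ι) (_ : DecidableEq α) (_ : DecidableEq π),
          Nonempty (CountRoadWitnessT3bWTVS D C O θv rr d n hn g₀ os ι α π)) :
    D.ym4_torus_continuum_limit_unique :=
  T4ApexHybrid.limit_unique_of_hybridNE7Under D hM
    (hybridNE7Under_of_countRoadT3bPWTVS_fsc D hM hsign h hμ d n hκ₁ hE₀ hA₀ hβ₀ hLβ hn₁ hn hθ hslack hE₂ hE₃ hsS hsmall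
      hθc0 hθc1 hθcs hData)

end Under

section SU

variable {F : T4Family} {N : ℕ} [NeZero N] {ℰ : LoopAverage (Matrix.specialUnitaryGroup (Fin N) ℂ)}

/-! ## §2 The four targets and the headline over the repaired END v3.1 from the weighted witness -/

/-- **THE FOUR T⁴ TARGETS FROM THE COUNT ROAD OVER THE REPAIRED END v3.1, WEIGHTED `κ := costT` WITNESS, SPLIT SLACK**,
for (0.4)-block-averaged data on `SU(N)` with a measurable small-loop average — the sibling's
`targets_of_countRoadT3bPWTV_fsc` at `reslack O θᵥ` through `toWTV`.  CONDITIONAL on (B), `BetaPertHyp` (inside the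
targets' own prefix) and the displayed prefixed witnesses; NE7b NOT proved. [folklore] -/
theorem targets_of_countRoadT3bPWTVS_fsc (D : FiniteEpsData F (Matrix.specialUnitaryGroup (Fin N) ℂ))
    (hBA : D.IsBlockAveraged ℰ) (hE : ℰ.MeasurableE) (hsign : B16.SignConventions D.C)
    {C : T4PrintedShapeBanking.Consts} {O : PrintedO1s}
    {rr : ℕ} {β₀ : ℝ} (h : ThresholdOK C F.L rr β₀) (hμ : 0 < C.μ) (d n : ℕ)
    (hκ₁ : (d : ℝ) * Real.log F.L + 2 * Real.log 2 ≤ C.κ₁) (hE₀ : Real.log (2 + birthMass C) ≤ C.E₀)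
    (hA₀ : 1 ≤ C.A₀) (hβ₀ : 0 < β₀) (hLβ : (F.L : ℝ) * β₀ ≤ 1) (hn₁ : 13 ≤ C.n₁) (hn : 0 < n)
    {θ θv : ℝ} (hθ : 0 < θ) (hslack : C.a + (θ + θv) ≤ O.γ₀ * O.A₁ ^ 2 / 2)
    (hE₂ : 0 < C.E₂) (hE₃ : 0 ≤ C.E₃) {sS : ℕ} (hsS : 1 ≤ sS)
    (hsmall : (((2 * cth 32 1 sS + 1) ^ d : ℕ) : ℝ) * (5 : ℝ) ^ d * ((max 1 (2 * 32 + 2) : ℕ) : ℝ) ≤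
      (F.L : ℝ) ^ (sS / 2) / 2)
    {θc : ℝ} (hθc0 : 0 ≤ θc) (hθc1 : θc < 1) (hθcs : 1 / 2 ≤ θc ^ sS)
    (hData : T4ContinuumYM4Torus.ForSmallCouplings D fun g₀ => ∀ os : List (ULoop F),
        ∃ (ι α π : Type) (_ : DecidableEq ι) (_ : DecidableEq α) (_ : DecidableEq π),
          Nonempty (CountRoadWitnessT3bWTVS D C O θv rr d n hn g₀ os ι α π)) :
    D.ym4_torus_continuum_limit_exists ∧ D.ym4_torus_continuum_limit_unique ∧
      D.limit_reflectionPositive ∧ D.limit_torusCovariant :=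
  targets_of_countRoadT3bPWTV_fsc D hBA hE hsign h hμ d n hκ₁ hE₀ hA₀ hβ₀ hLβ hn₁ hn hθ (reslack_hslack hslack) hE₂ hE₃ hsS
    hsmall hθc0 hθc1 hθcs
    (hData.mono fun g₀ hg os => by
      obtain ⟨ι, α, π, i₁, i₂, i₃, ⟨X⟩⟩ := hg os
      exact ⟨ι, α, π, i₁, i₂, i₃, ⟨X.toWTV⟩⟩)

/-- **THE HEADLINE PREDICATE FROM THE COUNT ROAD OVER THE REPAIRED END v3.1, WEIGHTED `κ := costT` WITNESS, SPLIT
SLACK**: `T4ContinuumYM4Torus.ContinuumYM4Torus D` for (0.4)-block-averaged data on `SU(N)` with a measurable small-loop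
average, GIVEN the two pins `(B) = B16.EndStatementBPrinted D.C` and `BetaPertHyp D.βfun` BY NAME, the datum's sign
conventions, the repaired END's INHABITED constants-only side conditions with the split slack `C.a + (θ + θᵥ) ≤
½γ₀A₁²` (`0 < θ`; NO demand on print's constants), and a `CountRoadWitnessT3bWTVS D C O θᵥ …` for all small-coupling
tuned runs and every loop string — the sibling's V-headline over E8T at `reslack O θᵥ` through leaf-02's `toWTV`.  The
witness displays the volume's class remainder as the weight family `uV` under D-V1 instead of reading it; nothing of
H3^NE7b is discharged here.  NE7b NOT proved; count 0∕9. [folklore] -/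
theorem continuumYM4Torus_of_countRoadT3bPWTVS_fsc (D : FiniteEpsData F (Matrix.specialUnitaryGroup (Fin N) ℂ))
    (hBA : D.IsBlockAveraged ℰ) (hE : ℰ.MeasurableE)
    (hB : B16.EndStatementBPrinted D.C) (hβ : BetaPertHyp D.βfun) (hsign : B16.SignConventions D.C)
    {C : T4PrintedShapeBanking.Consts} {O : PrintedO1s}
    {rr : ℕ} {β₀ : ℝ} (h : ThresholdOK C F.L rr β₀) (hμ : 0 < C.μ) (d n : ℕ)
    (hκ₁ : (d : ℝ) * Real.log F.L + 2 * Real.log 2 ≤ C.κ₁) (hE₀ : Real.log (2 + birthMass C) ≤ C.E₀)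
    (hA₀ : 1 ≤ C.A₀) (hβ₀ : 0 < β₀) (hLβ : (F.L : ℝ) * β₀ ≤ 1) (hn₁ : 13 ≤ C.n₁) (hn : 0 < n)
    {θ θv : ℝ} (hθ : 0 < θ) (hslack : C.a + (θ + θv) ≤ O.γ₀ * O.A₁ ^ 2 / 2)
    (hE₂ : 0 < C.E₂) (hE₃ : 0 ≤ C.E₃) {sS : ℕ} (hsS : 1 ≤ sS)
    (hsmall : (((2 * cth 32 1 sS + 1) ^ d : ℕ) : ℝ) * (5 : ℝ) ^ d * ((max 1 (2 * 32 + 2) : ℕ) : ℝ) ≤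
      (F.L : ℝ) ^ (sS / 2) / 2)
    {θc : ℝ} (hθc0 : 0 ≤ θc) (hθc1 : θc < 1) (hθcs : 1 / 2 ≤ θc ^ sS)
    (hData : T4ContinuumYM4Torus.ForSmallCouplings D fun g₀ => ∀ os : List (ULoop F),
        ∃ (ι α π : Type) (_ : DecidableEq ι) (_ : DecidableEq α) (_ : DecidableEq π),
          Nonempty (CountRoadWitnessT3bWTVS D C O θv rr d n hn g₀ os ι α π)) :
    T4ContinuumYM4Torus.ContinuumYM4Torus D :=
  continuumYM4Torus_of_countRoadT3bPWTV_fsc D hBA hE hB hβ hsign h hμ d n hκ₁ hE₀ hA₀ hβ₀ hLβ hn₁ hn hθ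
    (reslack_hslack hslack) hE₂ hE₃ hsS hsmall hθc0 hθc1 hθcs
    (hData.mono fun g₀ hg os => by
      obtain ⟨ι, α, π, i₁, i₂, i₃, ⟨X⟩⟩ := hg os
      exact ⟨ι, α, π, i₁, i₂, i₃, ⟨X.toWTV⟩⟩)

/-! ## §3 The re-homed VS-headline is at least as strong as leaf-02's VS-headline p266167 (round trip, by name) -/

/- **FROM p266167's OWN HYPOTHESES, ITS CONCLUSION THROUGH THE REPAIRED END v3.1 (kernel-checked `example`).**  Leaf-02's
VS-headline `HistoryRealiseCellsRunHeadlineT3bWTVS.continuumYM4Torus_of_countRoadT3bWTVS_fsc` (over E7T, END v3′) carries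
`hθ : 0 ≤ θ`, the split slack AND the demand `hθJ : ΘJ(d, sS, θc) + 8·2^d·log(2d+1) ≤ θ`; §2's headline needs `0 < θ`
and the split slack only.  `ΘJ ≥ 12`, so `hθJ` gives `0 < θ` and §2 applies to the SAME prefixed witness hypothesis.
Binders and conclusion are LITERALLY those of p266167's headline (hence an `example`; `hθ` is kept as a binder — spelled `_hθ`,
the TYPE is p266167's — but is superseded by `hθJ` and unused).  Nothing of print asserted; NE7b NOT proved. [folklore] -/
example (D : FiniteEpsData F (Matrix.specialUnitaryGroup (Fin N) ℂ))
    (hBA : D.IsBlockAveraged ℰ) (hE : ℰ.MeasurableE)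
    (hB : B16.EndStatementBPrinted D.C) (hβ : BetaPertHyp D.βfun) (hsign : B16.SignConventions D.C)
    {C : T4PrintedShapeBanking.Consts} {O : PrintedO1s}
    {rr : ℕ} {β₀ : ℝ} (h : ThresholdOK C F.L rr β₀) (hμ : 0 < C.μ) (d n : ℕ)
    (hκ₁ : (d : ℝ) * Real.log F.L + 2 * Real.log 2 ≤ C.κ₁) (hE₀ : Real.log (2 + birthMass C) ≤ C.E₀)
    (hA₀ : 1 ≤ C.A₀) (hβ₀ : 0 < β₀) (hLβ : (F.L : ℝ) * β₀ ≤ 1) (hn₁ : 13 ≤ C.n₁) (hn : 0 < n)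
    {θ θv : ℝ} (_hθ : 0 ≤ θ) (hslack : C.a + (θ + θv) ≤ O.γ₀ * O.A₁ ^ 2 / 2)
    (hE₂ : 0 < C.E₂) (hE₃ : 0 ≤ C.E₃) {sS : ℕ} (hsS : 1 ≤ sS)
    (hsmall : (((2 * cth 32 1 sS + 1) ^ d : ℕ) : ℝ) * (5 : ℝ) ^ d * ((max 1 (2 * 32 + 2) : ℕ) : ℝ) ≤
      (F.L : ℝ) ^ (sS / 2) / 2)
    {θc : ℝ} (hθc0 : 0 ≤ θc) (hθc1 : θc < 1) (hθcs : 1 / 2 ≤ θc ^ sS)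
    (hθJ : (2 +
            ((2 * (((2 * cth 32 1 sS + 1) ^ d : ℕ) : ℝ) * ((((2 * 32 + 1) ^ d : ℕ) : ℝ) * (4 * 2 ^ d)) +
                  4 * ((((2 * cth 32 1 sS + 1) ^ d : ℕ) : ℝ) * (5 : ℝ) ^ d)) / (1 - θc) +
              2 * (2 * ((((2 * cth 32 1 sS + 1) ^ d : ℕ) : ℝ) * (5 : ℝ) ^ d))) +
            (2 * ((0 + 2 * Real.log (2 * d + 1)) + (2 * (d : ℝ) + 2 * Real.log (2 * d + 1)) *
                  (((max 1 (2 * 32 + 2) : ℕ) : ℝ) * (2 * ((((2 * cth 32 1 sS + 1) ^ d : ℕ) : ℝ) * (5 : ℝ) ^ d)))) +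
              (2 * (d : ℝ) + 2 * Real.log (2 * d + 1)) * 1 *
                (((max 1 (2 * 32 + 2) : ℕ) : ℝ) *
                    ((2 * (((2 * cth 32 1 sS + 1) ^ d : ℕ) : ℝ) * ((((2 * 32 + 1) ^ d : ℕ) : ℝ) * (4 * 2 ^ d)) +
                        4 * ((((2 * cth 32 1 sS + 1) ^ d : ℕ) : ℝ) * (5 : ℝ) ^ d)) / (1 - θc)) +
                  4 * 2 ^ d)) +
            10) + 8 * 2 ^ d * Real.log (2 * d + 1) ≤ θ)
    (hData : T4ContinuumYM4Torus.ForSmallCouplings D fun g₀ => ∀ os : List (ULoop F),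
        ∃ (ι α π : Type) (_ : DecidableEq ι) (_ : DecidableEq α) (_ : DecidableEq π),
          Nonempty (CountRoadWitnessT3bWTVS D C O θv rr d n hn g₀ os ι α π)) :
    T4ContinuumYM4Torus.ContinuumYM4Torus D := by
  -- `_hθ : 0 ≤ θ` is superseded: the demand's left side is positive (`positivity` reads `θc < 1` for the
  -- quotient by `1 - θc` and `hL` for the logarithm)
  have hL : 0 ≤ Real.log (2 * (d : ℝ) + 1) := Real.log_nonneg (by linarith [(Nat.cast_nonneg d : (0 : ℝ) ≤ d)])
  set Q : ℝ := (2 * (((2 * cth 32 1 sS + 1) ^ d : ℕ) : ℝ) * ((((2 * 32 + 1) ^ d : ℕ) : ℝ) * (4 * 2 ^ d)) +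
      4 * ((((2 * cth 32 1 sS + 1) ^ d : ℕ) : ℝ) * (5 : ℝ) ^ d)) / (1 - θc)
  set Lg : ℝ := Real.log (2 * (d : ℝ) + 1)
  have hθ' : 0 < θ := by
    have hbig : 0 ≤ (Q + 2 * (2 * ((((2 * cth 32 1 sS + 1) ^ d : ℕ) : ℝ) * (5 : ℝ) ^ d))) +
        (2 * ((0 + 2 * Lg) + (2 * (d : ℝ) + 2 * Lg) *
              (((max 1 (2 * 32 + 2) : ℕ) : ℝ) * (2 * ((((2 * cth 32 1 sS + 1) ^ d : ℕ) : ℝ) * (5 : ℝ) ^ d)))) +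
          (2 * (d : ℝ) + 2 * Lg) * 1 * (((max 1 (2 * 32 + 2) : ℕ) : ℝ) * Q + 4 * 2 ^ d)) +
        8 * 2 ^ d * Lg := by positivity
    linarith
  exact continuumYM4Torus_of_countRoadT3bPWTVS_fsc D hBA hE hB hβ hsign h hμ d n hκ₁ hE₀ hA₀ hβ₀ hLβ hn₁ hn hθ' hslack
    hE₂ hE₃ hsS hsmall hθc0 hθc1 hθcs hData

end SU

/-! ## §4 The constants-side antecedent of the re-homed VS-headline is inhabited (with a positive `θᵥ`) -/

section Consts

/-- **THE CONSTANTS-SIDE ANTECEDENT OF THE RE-HOMED VS-HEADLINE IS INHABITED, WITH ROOM FOR A POSITIVE `θᵥ`** — for every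
positive printed `O`, every family `F`, every `d rr`: a record `C`, a `β₀`, positive shares `θ`, `θᵥ`, a stride `sS`, a
decay `θc` and an `n` meeting EVERY constants-side binder of `hybridNE7Under_of_countRoadT3bPWTVS_fsc` ∕
`continuumYM4Torus_of_countRoadT3bPWTVS_fsc` — BY NAME from the headline of record's `exists_consts_countRoadT3bP` (p224237),
its positive slack halved between the slot multiplicity (`θ`) and the volume remainder (`θᵥ`).  (The witness-side
display `huV : uV K j ≤ θᵥ·p₀(g_j)²` is DATA about the run, not a constants-side condition; contrast the v3′ chain, whose
antecedent forced `8·8710^d < ½γ₀A₁²` — `HistoryRealiseCellsRunHeadlineT3b`'s `demand_of_countRoadT3b_consts`.) [folklore] -/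
theorem exists_consts_countRoadT3bPWTVS {O : PrintedO1s} (hO : O.Pos) (F : T4Family) (d rr : ℕ) :
    ∃ (C : T4PrintedShapeBanking.Consts) (β₀ θ θv : ℝ) (sS : ℕ) (θc : ℝ) (n : ℕ),
      ThresholdOK C F.L rr β₀ ∧ 0 < C.μ ∧
      (d : ℝ) * Real.log F.L + 2 * Real.log 2 ≤ C.κ₁ ∧ Real.log (2 + birthMass C) ≤ C.E₀ ∧
      1 ≤ C.A₀ ∧ 0 < β₀ ∧ (F.L : ℝ) * β₀ ≤ 1 ∧ 13 ≤ C.n₁ ∧ 0 < n ∧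
      0 < θ ∧ 0 < θv ∧ C.a + (θ + θv) ≤ O.γ₀ * O.A₁ ^ 2 / 2 ∧ 0 < C.E₂ ∧ 0 ≤ C.E₃ ∧ 1 ≤ sS ∧
      (((2 * cth 32 1 sS + 1) ^ d : ℕ) : ℝ) * (5 : ℝ) ^ d * ((max 1 (2 * 32 + 2) : ℕ) : ℝ) ≤ (F.L : ℝ) ^ (sS / 2) / 2 ∧
      0 ≤ θc ∧ θc < 1 ∧ 1 / 2 ≤ θc ^ sS := by
  obtain ⟨C, β₀, θ, sS, θc, n, h, hμ, hκ₁, hE₀, hA₀, hβ₀, hLβ, hn₁, hn, hθ, hslack, hE₂, hE₃, hsS, hsmall, hθc0, hθc1,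
    hθcs⟩ := exists_consts_countRoadT3bP hO F d rr
  exact ⟨C, β₀, θ / 2, θ / 2, sS, θc, n, h, hμ, hκ₁, hE₀, hA₀, hβ₀, hLβ, hn₁, hn, by positivity, by positivity, by linarith,
    hE₂, hE₃, hsS, hsmall, hθc0, hθc1, hθcs⟩

end Consts

end

end Summit.QuantumFields.BalabanUV.T4Continuum.HistoryRealiseCellsRunHeadlineT3bPWTVS
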